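import Summits.CriticalPhenomena.CardyFormulaZ2.Theorems.CardyIKTransportIKMixedBoxCrossingTransportVerticalClause

/-!
# `IKMixedBoxCrossing` = (horizontal clause) ∧ (vertical clause): the TYPED SPLIT of the crux, with the vertical
# half PROVED (crux stmt-CriticalPhenomena-5911; strategist seat `cstrat-stmt-CriticalPhenomena-5911-s1`, 2026-08-17)

Support file (`--supports stmt-CriticalPhenomena-5911`).  The crux `IKMixedBoxCrossing` (routes CardyIKTransport /
CardyDiluteOrbit, definitionally one decl) asks, uniformly in the column pattern `S`, for BOTH long-way crossings: the
`2n × n` cell box left-to-right (HORIZONTAL clause, transverse to the typed columns) and the `n × 2n` box bottom-to-top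
(VERTICAL clause, parallel to the typed columns), with one constant `c > 0`.

* `HorizontalClause`, `VerticalClause` — the two halves, stated VERBATIM in the crux's own inline gauge (so that they can be
  filed as route items without importing any Theorems vocabulary), and their definitional bridges `horizontalClause_iff`,
  `verticalClause_iff` to the line vocabulary `pLR` / `pTB` (`…IKMixedBoxCrossingDefs.lean`).
* `verticalClause_holds : VerticalClause` — PROVED: it is the landed `DefectClosureExploration.verticalClause`
  (`…TransportVerticalClause.lean`, p138511: Yang–Baxter column exchange + monotonicity of link events in the face type +
  the tree's RSW on `𝕋`), moved across the bridge.
* `IKMixedBoxCrossing_of_subs : VerticalClause → HorizontalClause → IKMixedBoxCrossing` (hypotheses written INLINE, the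
  exact statements of the two split children) and `IKMixedBoxCrossing_of_horizontal : HorizontalClause → IKMixedBoxCrossing`:
  after this file THE CRUX IS EQUIVALENT TO ITS HORIZONTAL CLAUSE (`iKMixedBoxCrossing_iff_horizontal`).

Nothing here asserts the crux: `HorizontalClause` is the open residue (FKG-free RSW transverse to the typed columns,
uniformly in `S`; the live line's form of it is `ContactSecondMomentCol`, `…DefectGlueColDefs.lean`).
-/

noncomputable section

namespace Summit.CriticalPhenomena.CardyFormulaZ2.Cruxes.IKMixedBoxCrossing.Split

open scoped Classical Matrix
open MeasureTheory
open Summit.CriticalPhenomena.CardyFormulaZ2.Theorems.IKLinearTransport.PinnedDiagramExchange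
  (Ω μIK parSet blackSet antiSet obs blackEdges lrCross tbCross)
open Summit.CriticalPhenomena.CardyFormulaZ2.Cruxes.IKMixedBoxCrossing.PairedMirrorExploration
  (pLR pTB iff_cbox_transport diluteOrbit_iff_transport)

/-- **HORIZONTAL CLAUSE of the crux** (split child, OPEN): for every column pattern `S`, the `2n × n` cell box
`[a, a+2n) × [b, b+n)` is crossed LEFT-TO-RIGHT (transverse to the typed face columns) by a black path with probability
at least `c`, one `c > 0` for all `S, n ≥ 1, a, b`.  Verbatim first conjunct of `IKMixedBoxCrossing`.
  A statement to be proved (split child of the crux / skeleton glue), not asserted here. -/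
def HorizontalClause : Prop :=
  ∃ c : ℝ, 0 < c ∧ ∀ S : Set ℤ, ∀ n : ℕ, 1 ≤ n → ∀ a b : ℤ, let μ := (Literature.Probability.Percolation.sitePercolation ℤ Literature.Probability.Percolation.half).prod ((Literature.Probability.Percolation.sitePercolation ℤ Literature.Probability.Percolation.half).prod ((Literature.Probability.Percolation.sitePercolation (Literature.Probability.LatticeModels.Site 2) (Set.projIcc (0:ℝ) 1 zero_le_one (2 * Real.sqrt 3 - 3))).prod ((Literature.Probability.Percolation.sitePercolation (Literature.Probability.LatticeModels.Site 2) Literature.Probability.Percolation.half).prod (Literature.Probability.Percolation.sitePercolation (Literature.Probability.LatticeModels.Site 2) Literature.Probability.Percolation.half)))); let par : (Set ℤ × (Set ℤ × (Set (Literature.Probability.LatticeModels.Site 2) × (Set (Literature.Probability.LatticeModels.Site 2) × Set (Literature.Probability.LatticeModels.Site 2))))) → Literature.Probability.LatticeModels.Site 2 → Prop := fun ω f => (f 0 ∈ S ∧ f ∈ ω.2.2.1) ∨ (f 0 ∉ S ∧ f ∈ ω.2.2.2.1); let blk : (Set ℤ × (Set ℤ × (Set (Literature.Probability.LatticeModels.Site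 2) × (Set (Literature.Probability.LatticeModels.Site 2) × Set (Literature.Probability.LatticeModels.Site 2))))) → Literature.Probability.LatticeModels.Site 2 → Prop := fun ω v => Xor (v 0 ∈ ω.1) (Xor (v 1 ∈ ω.2.1) (Odd ((Finset.filter (fun f : ℤ × ℤ => par ω ![f.1, f.2]) (Finset.Ico (min 0 (v 0)) (max 0 (v 0)) ×ˢ Finset.Ico (min 0 (v 1)) (max 0 (v 1)))).card))); let anti : (Set ℤ × (Set ℤ × (Set (Literature.Probability.LatticeModels.Site 2) × (Set (Literature.Probability.LatticeModels.Site 2) × Set (Literature.Probability.LatticeModels.Site 2))))) → Literature.Probability.LatticeModels.Site 2 → Prop := fun ω f => f 0 ∉ S ∨ f ∈ ω.2.2.2.2; let edges : (Set ℤ × (Set ℤ × (Set (Literature.Probability.LatticeModels.Site 2) × (Set (Literature.Probability.LatticeModels.Site 2) × Set (Literature.Probability.LatticeModels.Site 2))))) → Literature.Probability.Percolation.BondConfig (Literature.Probability.LatticeModels.Site 2) := fun ω => {e | ∃ u v, e = s(u, v) ∧ blk ω u ∧ blk ω v ∧ (v = u + ![1, 0] ∨ v = u + ![0, 1] ∨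 (v = u + ![1, 1] ∧ ¬ anti ω u) ∨ (v = u + ![1, -1] ∧ anti ω (u + ![0, -1])))}; c ≤ μ.real {ω | edges ω ∈ Literature.Probability.Percolation.openCrossing {v | a ≤ v 0 ∧ v 0 < a + 2 * n ∧ b ≤ v 1 ∧ v 1 < b + n} {v | v 0 = a ∧ b ≤ v 1 ∧ v 1 < b + n} {v | v 0 = a + 2 * n - 1 ∧ b ≤ v 1 ∧ v 1 < b + n}}

/-- **VERTICAL CLAUSE of the crux** (split child, PROVED below): for every column pattern `S`, the `n × 2n` cell box
`[a, a+n) × [b, b+2n)` is crossed BOTTOM-TO-TOP (parallel to the typed face columns) by a black path with probability at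
least `c`.  Verbatim second conjunct of `IKMixedBoxCrossing`.
  A statement proved below (`verticalClause_holds`), not asserted here. -/
def VerticalClause : Prop :=
  ∃ c : ℝ, 0 < c ∧ ∀ S : Set ℤ, ∀ n : ℕ, 1 ≤ n → ∀ a b : ℤ, let μ := (Literature.Probability.Percolation.sitePercolation ℤ Literature.Probability.Percolation.half).prod ((Literature.Probability.Percolation.sitePercolation ℤ Literature.Probability.Percolation.half).prod ((Literature.Probability.Percolation.sitePercolation (Literature.Probability.LatticeModels.Site 2) (Set.projIcc (0:ℝ) 1 zero_le_one (2 * Real.sqrt 3 - 3))).prod ((Literature.Probability.Percolation.sitePercolation (Literature.Probability.LatticeModels.Site 2) Literature.Probability.Percolation.half).prod (Literature.Probability.Percolation.sitePercolation (Literature.Probability.LatticeModels.Site 2) Literature.Probability.Percolation.half)))); let par : (Set ℤ × (Set ℤ × (Set (Literature.Probability.LatticeModels.Site 2) × (Set (Literature.Probability.LatticeModels.Site 2) × Set (Literature.Probability.LatticeModels.Site 2))))) → Literature.Probability.LatticeModels.Site 2 → Prop := fun ω f => (f 0 ∈ S ∧ f ∈ ω.2.2.1) ∨ (f 0 ∉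 S ∧ f ∈ ω.2.2.2.1); let blk : (Set ℤ × (Set ℤ × (Set (Literature.Probability.LatticeModels.Site 2) × (Set (Literature.Probability.LatticeModels.Site 2) × Set (Literature.Probability.LatticeModels.Site 2))))) → Literature.Probability.LatticeModels.Site 2 → Prop := fun ω v => Xor (v 0 ∈ ω.1) (Xor (v 1 ∈ ω.2.1) (Odd ((Finset.filter (fun f : ℤ × ℤ => par ω ![f.1, f.2]) (Finset.Ico (min 0 (v 0)) (max 0 (v 0)) ×ˢ Finset.Ico (min 0 (v 1)) (max 0 (v 1)))).card))); let anti : (Set ℤ × (Set ℤ × (Set (Literature.Probability.LatticeModels.Site 2) × (Set (Literature.Probability.LatticeModels.Site 2) × Set (Literature.Probability.LatticeModels.Site 2))))) → Literature.Probability.LatticeModels.Site 2 → Prop := fun ω f => f 0 ∉ S ∨ f ∈ ω.2.2.2.2; let edges : (Set ℤ × (Set ℤ × (Set (Literature.Probability.LatticeModels.Site 2) × (Set (Literature.Probability.LatticeModels.Site 2) × Set (Literature.Probability.LatticeModels.Site 2))))) → Literature.Probability.Percolation.BondConfig (Literature.Probability.LatticeModels.Site 2) := fun ω => {e | ∃ u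 v, e = s(u, v) ∧ blk ω u ∧ blk ω v ∧ (v = u + ![1, 0] ∨ v = u + ![0, 1] ∨ (v = u + ![1, 1] ∧ ¬ anti ω u) ∨ (v = u + ![1, -1] ∧ anti ω (u + ![0, -1])))}; c ≤ μ.real {ω | edges ω ∈ Literature.Probability.Percolation.openCrossing {v | a ≤ v 0 ∧ v 0 < a + n ∧ b ≤ v 1 ∧ v 1 < b + 2 * n} {v | v 1 = b ∧ a ≤ v 0 ∧ v 0 < a + n} {v | v 1 = b + 2 * n - 1 ∧ a ≤ v 0 ∧ v 0 < a + n}}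

/-- Bridge (definitional): the horizontal clause in the line vocabulary `pLR`. -/
theorem horizontalClause_iff :
    HorizontalClause ↔ ∃ c : ℝ, 0 < c ∧ ∀ S : Set ℤ, ∀ n : ℕ, 1 ≤ n → ∀ a b : ℤ, c ≤ pLR S a b (2 * n) n := by
  simp only [HorizontalClause, pLR, lrCross, obs, blackEdges, blackSet, antiSet, parSet, μIK, Set.preimage_setOf_eq,
    Set.mem_setOf_eq, Nat.cast_mul, Nat.cast_ofNat]

/-- Bridge (definitional): the vertical clause in the line vocabulary `pTB`. -/
theorem verticalClause_iff :
    VerticalClause ↔ ∃ c : ℝ, 0 < c ∧ ∀ S : Set ℤ, ∀ n : ℕ, 1 ≤ n → ∀ a b : ℤ, c ≤ pTB S a b n (2 * n) := by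
  simp only [VerticalClause, pTB, tbCross, obs, blackEdges, blackSet, antiSet, parSet, μIK, Set.preimage_setOf_eq,
    Set.mem_setOf_eq, Nat.cast_mul, Nat.cast_ofNat]

/-- **THE VERTICAL CLAUSE HOLDS** (landed `DefectClosureExploration.verticalClause`, p138511, across the bridge). -/
theorem verticalClause_holds : VerticalClause := by
  rw [verticalClause_iff]
  obtain ⟨c, hc, h⟩ := DefectClosureExploration.verticalClause
  exact ⟨c, hc, fun S n hn a b => h S n a b hn⟩

/-- The crux from its two clauses (named form). -/
theorem IKMixedBoxCrossing_of_clauses (hV : VerticalClause) (hH : HorizontalClause) :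
    Summit.CriticalPhenomena.CardyFormulaZ2.Theses.CardyIKTransport.IKMixedBoxCrossing := by
  rw [iff_cbox_transport]
  rw [verticalClause_iff] at hV
  rw [horizontalClause_iff] at hH
  obtain ⟨c₁, hc₁, h₁⟩ := hV
  obtain ⟨c₂, hc₂, h₂⟩ := hH
  exact ⟨min c₁ c₂, lt_min hc₁ hc₂, fun S n hn a b =>
    ⟨(min_le_right _ _).trans (h₂ S n hn a b), (min_le_left _ _).trans (h₁ S n hn a b)⟩⟩

/-- Conversely the crux gives both clauses (so the split loses nothing). -/
theorem clauses_of_IKMixedBoxCrossing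
    (h : Summit.CriticalPhenomena.CardyFormulaZ2.Theses.CardyIKTransport.IKMixedBoxCrossing) :
    VerticalClause ∧ HorizontalClause := by
  rw [iff_cbox_transport] at h
  obtain ⟨c, hc, h⟩ := h
  refine ⟨?_, ?_⟩
  · rw [verticalClause_iff]
    exact ⟨c, hc, fun S n hn a b => (h S n hn a b).2⟩
  · rw [horizontalClause_iff]
    exact ⟨c, hc, fun S n hn a b => (h S n hn a b).1⟩

/-- **GLUE OF THE TYPED SPLIT** `IKMixedBoxCrossing ⇐ VerticalClause ∧ HorizontalClause`, hypotheses written INLINE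
(verbatim the statements of the two split children, so that the route-level split can cite this theorem by name). -/
theorem IKMixedBoxCrossing_of_subs :
    (∃ c : ℝ, 0 < c ∧ ∀ S : Set ℤ, ∀ n : ℕ, 1 ≤ n → ∀ a b : ℤ, let μ := (Literature.Probability.Percolation.sitePercolation ℤ Literature.Probability.Percolation.half).prod ((Literature.Probability.Percolation.sitePercolation ℤ Literature.Probability.Percolation.half).prod ((Literature.Probability.Percolation.sitePercolation (Literature.Probability.LatticeModels.Site 2) (Set.projIcc (0:ℝ) 1 zero_le_one (2 * Real.sqrt 3 - 3))).prod ((Literature.Probability.Percolation.sitePercolation (Literature.Probability.LatticeModels.Site 2) Literature.Probability.Percolation.half).prod (Literature.Probability.Percolation.sitePercolation (Literature.Probability.LatticeModels.Site 2) Literature.Probability.Percolation.half)))); let par : (Set ℤ × (Set ℤ × (Set (Literature.Probability.LatticeModels.Site 2) × (Set (Literature.Probability.LatticeModels.Site 2) × Set (Literature.Probability.LatticeModels.Site 2))))) → Literature.Probability.LatticeModels.Site 2 → Prop := fun ω f => (f 0 ∈ S ∧ f ∈ ω.2.2.1) ∨ (f 0 ∉ S ∧ f ∈ ω.2.2.2.1);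 let blk : (Set ℤ × (Set ℤ × (Set (Literature.Probability.LatticeModels.Site 2) × (Set (Literature.Probability.LatticeModels.Site 2) × Set (Literature.Probability.LatticeModels.Site 2))))) → Literature.Probability.LatticeModels.Site 2 → Prop := fun ω v => Xor (v 0 ∈ ω.1) (Xor (v 1 ∈ ω.2.1) (Odd ((Finset.filter (fun f : ℤ × ℤ => par ω ![f.1, f.2]) (Finset.Ico (min 0 (v 0)) (max 0 (v 0)) ×ˢ Finset.Ico (min 0 (v 1)) (max 0 (v 1)))).card))); let anti : (Set ℤ × (Set ℤ × (Set (Literature.Probability.LatticeModels.Site 2) × (Set (Literature.Probability.LatticeModels.Site 2) × Set (Literature.Probability.LatticeModels.Site 2))))) → Literature.Probability.LatticeModels.Site 2 → Prop := fun ω f => f 0 ∉ S ∨ f ∈ ω.2.2.2.2; let edges : (Set ℤ × (Set ℤ × (Set (Literature.Probability.LatticeModels.Site 2) × (Set (Literature.Probability.LatticeModels.Site 2) × Set (Literature.Probability.LatticeModels.Site 2))))) → Literature.Probability.Percolation.BondConfig (Literature.Probability.LatticeModels.Site 2) := fun ω => {e | ∃ u v, e = s(u, v) ∧ blk ω u ∧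 blk ω v ∧ (v = u + ![1, 0] ∨ v = u + ![0, 1] ∨ (v = u + ![1, 1] ∧ ¬ anti ω u) ∨ (v = u + ![1, -1] ∧ anti ω (u + ![0, -1])))}; c ≤ μ.real {ω | edges ω ∈ Literature.Probability.Percolation.openCrossing {v | a ≤ v 0 ∧ v 0 < a + n ∧ b ≤ v 1 ∧ v 1 < b + 2 * n} {v | v 1 = b ∧ a ≤ v 0 ∧ v 0 < a + n} {v | v 1 = b + 2 * n - 1 ∧ a ≤ v 0 ∧ v 0 < a + n}}) →
    (∃ c : ℝ, 0 < c ∧ ∀ S : Set ℤ, ∀ n : ℕ, 1 ≤ n → ∀ a b : ℤ, let μ := (Literature.Probability.Percolation.sitePercolation ℤ Literature.Probability.Percolation.half).prod ((Literature.Probability.Percolation.sitePercolation ℤ Literature.Probability.Percolation.half).prod ((Literature.Probability.Percolation.sitePercolation (Literature.Probability.LatticeModels.Site 2) (Set.projIcc (0:ℝ) 1 zero_le_one (2 * Real.sqrt 3 - 3))).prod ((Literature.Probability.Percolation.sitePercolation (Literature.Probability.LatticeModels.Site 2) Literature.Probability.Percolation.half).prod (Literature.Probability.Percolation.sitePercolation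 (Literature.Probability.LatticeModels.Site 2) Literature.Probability.Percolation.half)))); let par : (Set ℤ × (Set ℤ × (Set (Literature.Probability.LatticeModels.Site 2) × (Set (Literature.Probability.LatticeModels.Site 2) × Set (Literature.Probability.LatticeModels.Site 2))))) → Literature.Probability.LatticeModels.Site 2 → Prop := fun ω f => (f 0 ∈ S ∧ f ∈ ω.2.2.1) ∨ (f 0 ∉ S ∧ f ∈ ω.2.2.2.1); let blk : (Set ℤ × (Set ℤ × (Set (Literature.Probability.LatticeModels.Site 2) × (Set (Literature.Probability.LatticeModels.Site 2) × Set (Literature.Probability.LatticeModels.Site 2))))) → Literature.Probability.LatticeModels.Site 2 → Prop := fun ω v => Xor (v 0 ∈ ω.1) (Xor (v 1 ∈ ω.2.1) (Odd ((Finset.filter (fun f : ℤ × ℤ => par ω ![f.1, f.2]) (Finset.Ico (min 0 (v 0)) (max 0 (v 0)) ×ˢ Finset.Ico (min 0 (v 1)) (max 0 (v 1)))).card))); let anti : (Set ℤ × (Set ℤ × (Set (Literature.Probability.LatticeModels.Site 2) × (Set (Literature.Probability.LatticeModels.Site 2) × Set (Literature.Probability.LatticeModels.Site 2))))) → Literature.Probability.LatticeModels.Site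 2 → Prop := fun ω f => f 0 ∉ S ∨ f ∈ ω.2.2.2.2; let edges : (Set ℤ × (Set ℤ × (Set (Literature.Probability.LatticeModels.Site 2) × (Set (Literature.Probability.LatticeModels.Site 2) × Set (Literature.Probability.LatticeModels.Site 2))))) → Literature.Probability.Percolation.BondConfig (Literature.Probability.LatticeModels.Site 2) := fun ω => {e | ∃ u v, e = s(u, v) ∧ blk ω u ∧ blk ω v ∧ (v = u + ![1, 0] ∨ v = u + ![0, 1] ∨ (v = u + ![1, 1] ∧ ¬ anti ω u) ∨ (v = u + ![1, -1] ∧ anti ω (u + ![0, -1])))}; c ≤ μ.real {ω | edges ω ∈ Literature.Probability.Percolation.openCrossing {v | a ≤ v 0 ∧ v 0 < a + 2 * n ∧ b ≤ v 1 ∧ v 1 < b + n} {v | v 0 = a ∧ b ≤ v 1 ∧ v 1 < b + n} {v | v 0 = a + 2 * n - 1 ∧ b ≤ v 1 ∧ v 1 < b + n}}) →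
    Summit.CriticalPhenomena.CardyFormulaZ2.Theses.CardyIKTransport.IKMixedBoxCrossing :=
  IKMixedBoxCrossing_of_clauses

/-- **THE CRUX REDUCES TO ITS HORIZONTAL CLAUSE.** -/
theorem IKMixedBoxCrossing_of_horizontal :
    HorizontalClause → Summit.CriticalPhenomena.CardyFormulaZ2.Theses.CardyIKTransport.IKMixedBoxCrossing :=
  fun hH => IKMixedBoxCrossing_of_clauses verticalClause_holds hH

/-- The same for the home-route copy of the decl (CardyDiluteOrbit). -/
theorem IKMixedBoxCrossing_of_horizontal_diluteOrbit :
    HorizontalClause → Summit.CriticalPhenomena.CardyFormulaZ2.Theses.CardyDiluteOrbit.IKMixedBoxCrossing :=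
  fun hH => diluteOrbit_iff_transport.2 (IKMixedBoxCrossing_of_horizontal hH)

/-- After the vertical clause, the crux is EQUIVALENT to the horizontal clause. -/
theorem iKMixedBoxCrossing_iff_horizontal :
    Summit.CriticalPhenomena.CardyFormulaZ2.Theses.CardyIKTransport.IKMixedBoxCrossing ↔ HorizontalClause :=
  ⟨fun h => (clauses_of_IKMixedBoxCrossing h).2, IKMixedBoxCrossing_of_horizontal⟩

end Summit.CriticalPhenomena.CardyFormulaZ2.Cruxes.IKMixedBoxCrossing.Split

end
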